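import Literature.Probability.Percolation.KozmaNitzanPreFKG
import HarnessLib

/-!
# `NoHeavyLowerTail` (stmt-CriticalPhenomena-4575) — the QUANTITATIVE pre-FKG inequality for two relays on
# EVERY finite weighted graph: the base case `|A| = 2` of conjecture Q-KN (new-inequality factory `prim-ineq-gen-6`, gen 4)

No definitions, no named facts, no sorries.  Memo `run/shared/lean/prim/prim-ineq-gen-6/FINDING-G4.md` §8.

THEOREM (`quantitativePreFKG_pair`).  For every finite weighted graph (`μ = prodBernoulli w`), observer `o`,
target `b` and two relays `a₁ ≠ a₂`, with `D = {a₁ ↮ a₂}` and the Kozma–Nitzan ratio `φ₁ = μ(D ∩ {a₁ ↔ o}) / μ(D)`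
(`= P(o ↔ a₁ | a₁ ↮ a₂)`; `0` if `μ(D) = 0`):

  `P(o ↔ b, o ↔ A) − P(o ↔ A, a₂ ↔ b)  ≥  φ₁ · [ P(a₁ ↔ b) − P(a₂ ↔ b) ]`,   `A = {a₁, a₂}`.

So if `a₂` is the more detached relay (`P(a₂ ↔ b) ≤ P(a₁ ↔ b)`) the pre-FKG inequality (3) of Kozma–Nitzan
(arXiv:2401.12397, p. 3) holds for `a₂` with an explicit nonnegative slack.  This is the `|A| = 2` case of the
conjecture Q-KN of the memo (the same statement for every `|A|` and the most detached relay; 0 violations in `> 10⁶`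
exact instances).  Proof = two applications of the van den Berg–Häggström–Kahn inequalities of the tree
(`KNPreFKG.bhk_one_upper_upper`, `KNPreFKG.bhk_two_upper_upper`) on `D`:
`μ(D ∩ {o↔a₁} ∩ {a₁↔b})·μ(D) ≥ μ(D ∩ {o↔a₁})·μ(D ∩ {a₁↔b})` and
`μ(D)·μ(D ∩ {o↔a₁} ∩ {a₂↔b}) ≤ μ(D ∩ {o↔a₁})·μ(D ∩ {a₂↔b})`, plus the pointwise identities
`1{o↔b, o↔A} − 1{o↔A, a₂↔b} = 1{D, o↔a₁, a₁↔b} − 1{D, o↔a₁, a₂↔b}` and `1{a₁↔b} − 1{a₂↔b} = 1{D,a₁↔b} − 1{D,a₂↔b}`.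
(Kozma–Nitzan's Theorem 1 is the mixture form with weights `φ₁, φ₂`; the remark after it notes a Lemma-3 route to
`(3)` for the minimiser — the present statement records the exact slack.)
-/

noncomputable section

open MeasureTheory Set
open Literature.Probability.LatticeModels (prodBernoulli)
open Literature.Probability.Percolation Literature.Probability.Percolation.KNPreFKG

namespace Summit.CriticalPhenomena.PercolationContinuityZ3.Theorems

namespace QuantitativePreFKG

variable {V : Type*} [Fintype V]

/-- Difference of measures from a pointwise identity of indicator differences. [folklore] -/
theorem real_sub_eq_of_indicator (μ : Measure (BondConfig V)) [IsFiniteMeasure μ]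
    (E₁ E₂ E₃ E₄ : Set (BondConfig V))
    (h : ∀ ω, (E₁.indicator (1 : BondConfig V → ℝ) ω) - E₂.indicator 1 ω = E₃.indicator 1 ω - E₄.indicator 1 ω) :
    μ.real E₁ - μ.real E₂ = μ.real E₃ - μ.real E₄ := by
  have i1 : ∫ ω, E₁.indicator (1 : BondConfig V → ℝ) ω ∂μ = μ.real E₁ := integral_indicator_one MeasurableSet.of_discrete
  have i2 : ∫ ω, E₂.indicator (1 : BondConfig V → ℝ) ω ∂μ = μ.real E₂ := integral_indicator_one MeasurableSet.of_discrete
  have i3 : ∫ ω, E₃.indicator (1 : BondConfig V → ℝ) ω ∂μ = μ.real E₃ := integral_indicator_one MeasurableSet.of_discrete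
  have i4 : ∫ ω, E₄.indicator (1 : BondConfig V → ℝ) ω ∂μ = μ.real E₄ := integral_indicator_one MeasurableSet.of_discrete
  have hint : ∀ E : Set (BondConfig V), Integrable (E.indicator (1 : BondConfig V → ℝ)) μ :=
    fun E => (integrable_const (1 : ℝ)).indicator MeasurableSet.of_discrete
  have key : ∫ ω, (E₁.indicator (1 : BondConfig V → ℝ) ω - E₂.indicator 1 ω) ∂μ =
      ∫ ω, (E₃.indicator (1 : BondConfig V → ℝ) ω - E₄.indicator 1 ω) ∂μ :=
    integral_congr_ae (Filter.Eventually.of_forall h)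
  rw [integral_sub (hint E₁) (hint E₂), integral_sub (hint E₃) (hint E₄), i1, i2, i3, i4] at key
  exact key

/-- **Quantitative pre-FKG inequality for two relays** (conjecture Q-KN at `|A| = 2`, PROVED for every finite weighted
graph): `P(o↔b, o↔A) − P(o↔A, a₂↔b) ≥ φ₁·[P(a₁↔b) − P(a₂↔b)]` with `φ₁ = μ({a₁↮a₂} ∩ {a₁↔o})/μ({a₁↮a₂})`.
[this work; tools: BHK 2006 Thms 1.3/1.4 as in the tree] -/
theorem quantitativePreFKG_pair (w : Sym2 V → unitInterval) (o b a₁ a₂ : V) (h12 : a₁ ≠ a₂) :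
    (prodBernoulli w).real ({ω : BondConfig V | ¬ (openGraph ω).Reachable a₁ a₂} ∩
          {ω | (openGraph ω).Reachable a₁ o}) /
        (prodBernoulli w).real {ω : BondConfig V | ¬ (openGraph ω).Reachable a₁ a₂} *
      ((prodBernoulli w).real {ω : BondConfig V | (openGraph ω).Reachable a₁ b} -
        (prodBernoulli w).real {ω : BondConfig V | (openGraph ω).Reachable a₂ b}) ≤
    (prodBernoulli w).real ({ω : BondConfig V | (openGraph ω).Reachable o b} ∩
        {ω | (openGraph ω).Reachable o a₁ ∨ (openGraph ω).Reachable o a₂}) -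
      (prodBernoulli w).real ({ω : BondConfig V | (openGraph ω).Reachable o a₁ ∨ (openGraph ω).Reachable o a₂} ∩
        {ω | (openGraph ω).Reachable a₂ b}) := by
  set μ := prodBernoulli w with hμ
  set D : Set (BondConfig V) := {ω | ¬ (openGraph ω).Reachable a₁ a₂} with hD
  set Oa : Set (BondConfig V) := {ω | (openGraph ω).Reachable a₁ o} with hOa
  set A1 : Set (BondConfig V) := {ω | (openGraph ω).Reachable a₁ b} with hA1
  set A2 : Set (BondConfig V) := {ω | (openGraph ω).Reachable a₂ b} with hA2
  set OB : Set (BondConfig V) := {ω | (openGraph ω).Reachable o b} with hOB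
  set OA : Set (BondConfig V) := {ω | (openGraph ω).Reachable o a₁ ∨ (openGraph ω).Reachable o a₂} with hOA
  -- (1) the two pointwise identities
  have hU : μ.real (OB ∩ OA) - μ.real (OA ∩ A2) = μ.real (D ∩ Oa ∩ A1) - μ.real (D ∩ Oa ∩ A2) := by
    refine real_sub_eq_of_indicator μ _ _ _ _ fun ω => ?_
    by_cases hd : (openGraph ω).Reachable a₁ a₂
    · -- `a₁ ↔ a₂`: both differences vanish
      have hnD : ω ∉ D := fun h => h hd
      have h3 : ω ∉ D ∩ Oa ∩ A1 := fun h => hnD h.1.1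
      have h4 : ω ∉ D ∩ Oa ∩ A2 := fun h => hnD h.1.1
      by_cases hoa : ω ∈ OA
      · have ho2 : (openGraph ω).Reachable o a₂ := by
          rcases hoa with h | h
          · exact h.trans hd
          · exact h
        by_cases hb : (openGraph ω).Reachable a₂ b
        · have h1 : ω ∈ OB ∩ OA := ⟨ho2.trans hb, hoa⟩
          have h2 : ω ∈ OA ∩ A2 := ⟨hoa, hb⟩
          simp [h1, h2, h3, h4]
        · have h1 : ω ∉ OB ∩ OA := fun h => hb (ho2.symm.trans h.1)
          have h2 : ω ∉ OA ∩ A2 := fun h => hb h.2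
          simp [h1, h2, h3, h4]
      · have h1 : ω ∉ OB ∩ OA := fun h => hoa h.2
        have h2 : ω ∉ OA ∩ A2 := fun h => hoa h.1
        simp [h1, h2, h3, h4]
    · have hDm : ω ∈ D := hd
      by_cases ho1 : (openGraph ω).Reachable o a₁
      · have hno2 : ¬ (openGraph ω).Reachable o a₂ := fun h => hd (ho1.symm.trans h)
        have hoa : ω ∈ OA := Or.inl ho1
        have hOa' : ω ∈ Oa := ho1.symm
        by_cases hb1 : (openGraph ω).Reachable a₁ b
        · have e1 : ω ∈ OB ∩ OA := ⟨ho1.trans hb1, hoa⟩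
          have e3 : ω ∈ D ∩ Oa ∩ A1 := ⟨⟨hDm, hOa'⟩, hb1⟩
          by_cases hb2 : (openGraph ω).Reachable a₂ b
          · have e2 : ω ∈ OA ∩ A2 := ⟨hoa, hb2⟩
            have e4 : ω ∈ D ∩ Oa ∩ A2 := ⟨⟨hDm, hOa'⟩, hb2⟩
            simp [e1, e2, e3, e4]
          · have e2 : ω ∉ OA ∩ A2 := fun h => hb2 h.2
            have e4 : ω ∉ D ∩ Oa ∩ A2 := fun h => hb2 h.2
            simp [e1, e2, e3, e4]
        · have e1 : ω ∉ OB ∩ OA := fun h => hb1 (ho1.symm.trans h.1)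
          have e3 : ω ∉ D ∩ Oa ∩ A1 := fun h => hb1 h.2
          by_cases hb2 : (openGraph ω).Reachable a₂ b
          · have e2 : ω ∈ OA ∩ A2 := ⟨hoa, hb2⟩
            have e4 : ω ∈ D ∩ Oa ∩ A2 := ⟨⟨hDm, hOa'⟩, hb2⟩
            simp [e1, e2, e3, e4]
          · have e2 : ω ∉ OA ∩ A2 := fun h => hb2 h.2
            have e4 : ω ∉ D ∩ Oa ∩ A2 := fun h => hb2 h.2
            simp [e1, e2, e3, e4]
      · have e3 : ω ∉ D ∩ Oa ∩ A1 := fun h => ho1 h.1.2.symm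
        have e4 : ω ∉ D ∩ Oa ∩ A2 := fun h => ho1 h.1.2.symm
        by_cases ho2 : (openGraph ω).Reachable o a₂
        · have hoa : ω ∈ OA := Or.inr ho2
          by_cases hb2 : (openGraph ω).Reachable a₂ b
          · have e1 : ω ∈ OB ∩ OA := ⟨ho2.trans hb2, hoa⟩
            have e2 : ω ∈ OA ∩ A2 := ⟨hoa, hb2⟩
            simp [e1, e2, e3, e4]
          · have e1 : ω ∉ OB ∩ OA := fun h => hb2 (ho2.symm.trans h.1)
            have e2 : ω ∉ OA ∩ A2 := fun h => hb2 h.2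
            simp [e1, e2, e3, e4]
        · have hoa : ω ∉ OA := fun h => h.elim ho1 ho2
          have e1 : ω ∉ OB ∩ OA := fun h => hoa h.2
          have e2 : ω ∉ OA ∩ A2 := fun h => hoa h.1
          simp [e1, e2, e3, e4]
  have hH : μ.real A1 - μ.real A2 = μ.real (D ∩ A1) - μ.real (D ∩ A2) := by
    refine real_sub_eq_of_indicator μ _ _ _ _ fun ω => ?_
    by_cases hd : (openGraph ω).Reachable a₁ a₂
    · have hnD : ω ∉ D := fun h => h hd
      have e3 : ω ∉ D ∩ A1 := fun h => hnD h.1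
      have e4 : ω ∉ D ∩ A2 := fun h => hnD h.1
      by_cases hb : (openGraph ω).Reachable a₂ b
      · have e1 : ω ∈ A1 := hd.trans hb
        have e2 : ω ∈ A2 := hb
        simp [e1, e2, e3, e4]
      · have e1 : ω ∉ A1 := fun h => hb (hd.symm.trans h)
        have e2 : ω ∉ A2 := hb
        simp [e1, e2, e3, e4]
    · have hDm : ω ∈ D := hd
      by_cases hb1 : (openGraph ω).Reachable a₁ b <;> by_cases hb2 : (openGraph ω).Reachable a₂ b
      · have e1 : ω ∈ A1 := hb1
        have e2 : ω ∈ A2 := hb2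
        have e3 : ω ∈ D ∩ A1 := ⟨hDm, hb1⟩
        have e4 : ω ∈ D ∩ A2 := ⟨hDm, hb2⟩
        simp [e1, e2, e3, e4]
      · have e1 : ω ∈ A1 := hb1
        have e2 : ω ∉ A2 := hb2
        have e3 : ω ∈ D ∩ A1 := ⟨hDm, hb1⟩
        have e4 : ω ∉ D ∩ A2 := fun h => hb2 h.2
        simp [e1, e2, e3, e4]
      · have e1 : ω ∉ A1 := hb1
        have e2 : ω ∈ A2 := hb2
        have e3 : ω ∉ D ∩ A1 := fun h => hb1 h.2
        have e4 : ω ∈ D ∩ A2 := ⟨hDm, hb2⟩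
        simp [e1, e2, e3, e4]
      · have e1 : ω ∉ A1 := hb1
        have e2 : ω ∉ A2 := hb2
        have e3 : ω ∉ D ∩ A1 := fun h => hb1 h.2
        have e4 : ω ∉ D ∩ A2 := fun h => hb2 h.2
        simp [e1, e2, e3, e4]
  -- (2) the two BHK inequalities on `D = {a₁ ↮ a₂}`
  have hDX : D = {ω : BondConfig V | ∀ x ∈ ({a₂} : Set V), ¬ (openGraph ω).Reachable a₁ x} := by
    ext ω; simp [hD]
  have hOa' : Oa = {ω : BondConfig V | openEdgeCluster ω a₁ ∈ connFamily a₁ o} := by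
    ext ω; exact reachable_iff_exists_mem_openEdgeCluster ω a₁ o
  have hA1' : A1 = {ω : BondConfig V | openEdgeCluster ω a₁ ∈ connFamily a₁ b} := by
    ext ω; exact reachable_iff_exists_mem_openEdgeCluster ω a₁ b
  have hA2' : A2 = {ω : BondConfig V | openEdgeCluster ω a₂ ∈ connFamily a₂ b} := by
    ext ω; exact reachable_iff_exists_mem_openEdgeCluster ω a₂ b
  have hpos : μ.real (D ∩ Oa) * μ.real (D ∩ A1) ≤ μ.real D * μ.real (D ∩ (Oa ∩ A1)) := by
    have k := bhk_one_upper_upper w a₁ ({a₂} : Set V) (by simpa using h12)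
      (isUpperSet_connFamily a₁ o) (isUpperSet_connFamily a₁ b)
    rw [← hDX, ← hOa', ← hA1'] at k
    exact k
  have hneg : μ.real D * μ.real (D ∩ (Oa ∩ A2)) ≤ μ.real (D ∩ Oa) * μ.real (D ∩ A2) := by
    have k := bhk_two_upper_upper w a₁ a₂ h12 (isUpperSet_connFamily a₁ o) (isUpperSet_connFamily a₂ b)
    rw [← hOa', ← hA2'] at k
    exact k
  -- (3) assemble
  rw [hU, hH]
  have e3 : D ∩ Oa ∩ A1 = D ∩ (Oa ∩ A1) := Set.inter_assoc _ _ _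
  have e4 : D ∩ Oa ∩ A2 = D ∩ (Oa ∩ A2) := Set.inter_assoc _ _ _
  rw [e3, e4]
  by_cases hD0 : μ.real D = 0
  · -- all four events are null
    have n1 : μ.real (D ∩ (Oa ∩ A1)) = 0 :=
      le_antisymm (le_trans (measureReal_mono Set.inter_subset_left) (le_of_eq hD0)) measureReal_nonneg
    have n2 : μ.real (D ∩ (Oa ∩ A2)) = 0 :=
      le_antisymm (le_trans (measureReal_mono Set.inter_subset_left) (le_of_eq hD0)) measureReal_nonneg
    rw [hD0, div_zero, zero_mul, n1, n2, sub_self]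
  · have hDpos : 0 < μ.real D := lt_of_le_of_ne measureReal_nonneg (Ne.symm hD0)
    rw [div_mul_eq_mul_div, div_le_iff₀ hDpos, mul_sub, sub_mul]
    nlinarith [hpos, hneg]

end QuantitativePreFKG

end Summit.CriticalPhenomena.PercolationContinuityZ3.Theorems

end
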